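/-
Copyright (c) 2026 the pub-hodgecm-mathlib formalisation cell (harness21).  Prover seat hodgecm-mathlib-K2E3-p32 (g0), HCML Track B «K2-LIT» (close-out strike line L4
`stub_StCharTS`), h413 = `stmt-HodgeConjecture-24833`, line `K2_E3_EllipticInputs`, unit U4 «Keys», PART «U4Keys» socket :155 (U4f-χ₁-ram-one-d0B)
`sig_K2E3KeysThmTwoContractingRamifiedCharOneDepthZeroNormTrivial` (LINE-LEAD K2E3-plan (g5), deal D162 «d0B lead ∕ consumer», cell «U4-RAM»; plan of record K2E3-p06 (g4)
DESIGN-M2-v2 (O2) ∕ PAPER-Z3-DepthZeroInert; Z3-c SHARED FRAME v1 (K2E3-p03 (g9))): THE d0B END ASSEMBLY — «reducible `i(χ₁, 1)` ⟹ `det M = 0` ⟹ `Y = −1∕q` ⟹ `χ₁ = η·‖·‖^{1∕2}`»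
on `U(Φ₃)(L⁺_v)` at an inert place, with ONLY the two big-cell entries and their integrability left as hypotheses.  2026-09-04.
-/
import Summits.HodgeConjecture.HodgeConjecture.Theorems.K2E3TypeVectorInKernelDepthZeroCM        -- ★∕📤 (this seat) reducible ⟹ the `(I, χ̃)`-type vector killed by every `Λ_g` (the ★ Z2A-5 chain, branch-free, staged)
import Summits.HodgeConjecture.HodgeConjecture.Theorems.K2E3BranchBDeterminantZeroDepthZero       -- ★ (this seat) Z2-B on `U(Φ₃)(L⁺_v)`: type vector ⟹ `det M = 0`
import Summits.HodgeConjecture.HodgeConjecture.Theorems.K2E3KeysThmTwoDepthZeroBranchBFromDet      -- ★ (this seat) `det M = 0` + big-cell entries ⟹ `∃ η` (★ Constants, ★ LettersToRoot∕Z4, ★ Z5 inside)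
import HarnessLib

/-!
# K2 ∕ E3 «EllipticInputs», unit U4 «Keys» — (U4f-χ₁-ram-one-d0B) THE END ASSEMBLY AT AN INERT PLACE:
# reducible `i(χ₁, 1)` (Branch B, depth zero) ⟹ `det M = 0` ⟹ `Y = χ₁(ϖ̂) = −1∕q` ⟹ `χ₁ = η · ‖·‖^{1∕2}`, `η|_{norms} = 1`, `η(ϖ̂) = −1` — the SECOND DISJUNCT of the socket :155,
# modulo ONLY the two big-cell entries `G₁ = Λ_1 f₁`, `G₂ = Λ_{w₀} f_w` and the integrability of their integrands ((II)-a∕b∕c of the «U4-RAM» chain)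
# [Keys1984 §3, §7 Thm (2); Casselman1980 §3; Casselman1995 §6.4, Thm. 6.6.2; Rogawski1990 §12.2; Roche1998 §3–§4]

Cell `pub/hodgecm-mathlib`, crux H413 = `stmt-HodgeConjecture-24833`, route of record `HCCMUnconditional`; chair K2-lead (g2), LINE-LEAD∕dealer K2E3-plan (g5), architect K2E3-p25
(g3); cell «U4-RAM» (Z3-c frame v1, K2E3-p03 (g9); typists K2E3-p26 (II)-a, R90-C10-p04 (II)-b2 ∕ ★ HaarFactsN, K2E3-p03 (II)-b3, R90-C10-p01 (II)-c).  THEOREMS ONLY (no `def`,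
no `instance`, no `notation`, no named-fact hypothesis, no `sorry`); lane `--supports stmt-HodgeConjecture-24833 --as helper`, count-neutral.  NOT THE PAYER: the big-cell entries
`h11v`, `hwwv` and the integrabilities `hi₁₁`, `hiw₂` are the analytic core Z3 being typed by the cell; the basis `(f₁, f_w)` is taken as given (it exists: ★ `K2E3BranchBTypeBasisCM`);
dyadic inert and ramified places are separate theorems.

THE POINT.  Composition of the ★ bricks of the d0B chain, in the (G3)-frame on `U(Φ₃)(L⁺_v)` with `w₀` the element of matrix `Φ₃` and a Haar `μ` on `N(L⁺_v)`:
* **`det_intertwiningIntegral_eq_zero_of_reducible`** — `i(χ₁, 1)` reducible ⟹ `Λ_1 f₁ · Λ_{w₀} f_w − Λ_1 f_w · Λ_{w₀} f₁ = 0` for every normalised `(I, χ̃)`-type basis with integrable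
  cell integrands (★ `exists_typeVector_forall_intertwiningIntegral_eq_zero_of_reducible` + ★ `K2E3BranchBDeterminantZeroDepthZero.det_intertwiningIntegral_eq_zero_of_typeVector`):
  PAPER-Z3 §2 «reducible ⟹ det M = 0», assembled.
* **`exists_eta_of_reducible_of_bigCellEntries`** — at a non-split `v` UNRAMIFIED in `L`, Branch B, depth zero: reducible + the two BIG-CELL entries
  `Λ_1 f₁ = c₂·(ε₀·((q−1)∕q²)·μ(N₀)·Y∕(1+Y))`, `Λ_{w₀} f_w = −c₂·(ε₀·((q−1)∕q²)·μ(N₀)∕(1+Y))` (`ε₀² = c₂² = 1`) with integrable integrands ⟹ **`∃ η`, `IsQuadraticCharExtension σ η ∧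
  Continuous η ∧ χ₁ = η · halfModulusChar`** (★ `K2E3KeysThmTwoDepthZeroBranchBFromDet.exists_eta_of_det_eq_zero_of_bigCellEntries`, the constant entries and integrabilities ★
  `K2E3KeysThmTwoDepthZeroBranchBConstants`).
WHAT REMAINS for :155 at an inert odd `v`: ONLY `h11v`, `hwwv`, `hi₁₁`, `hiw₂` ((II)-c `K2E3BranchBCasselmanPairEntries` over (II)-a `K2E3BranchBShellScaling`, (II)-b2
`K2E3BranchBSkewLineCharacterIntegral`, (II)-b3 `K2E3BranchBShellZero`) and the choice of basis (★ `K2E3BranchBTypeBasisCM`); then the leaf's SECOND disjunct holds whenever `i(χ₁, 1)` is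
reducible — i.e. :155 at inert odd places.  Dyadic inert and ramified `v`: separate (R90-C10-p05 «vacuity» ∕ PAPER-Z3-Ramified).
HONEST LABEL.  HC_CM is proved only modulo the 7 printed citations (2 remaining named inputs: hLiu418 = `stmt-HodgeConjecture-24832`, h413 = `stmt-HodgeConjecture-24833`) until rung 0
closes; count-neutral — this file does NOT pay the leaf; no printed citation is discharged.

## References
* [Keys1984] D. Keys, Compositio Math. 51 (1984), §3, §7 Theorem (2) p. 126.
* [Casselman1980] W. Casselman, Compositio Math. 40 (1980), §3.
* [Casselman1995] W. Casselman, *Introduction to the theory of admissible representations of `p`-adic reductive groups* (1995), §6.4, Thm. 6.6.2.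
* [Rogawski1990] J. Rogawski, Ann. of Math. Stud. 123 (1990), §12.2 (1)–(2) p. 173.
* [Roche1998] A. Roche, Ann. Sci. ÉNS (4) 31 (1998), §3–§4.
-/

set_option autoImplicit false
-- the mandated namespace has the single-problem summit's repeated segment (`HodgeConjecture.HodgeConjecture`)
set_option linter.dupNamespace false

noncomputable section

open NumberField IsDedekindDomain MeasureTheory
open scoped Matrix MatrixGroups WithZero Valued
open Literature.NumberTheory Literature.NumberTheory.Automorphic Literature.NumberTheory.Automorphic.UnitaryGroup
open Literature.NumberTheory.Rogawski1990

namespace Summit.HodgeConjecture.HodgeConjecture.Cruxes.H413.K2E3KeysThmTwoDepthZeroBranchBAssembly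

open Summit.HodgeConjecture.HodgeConjecture.Cruxes.H413
open Summit.HodgeConjecture.HodgeConjecture.Cruxes.H413.K2E3DepthZeroIwahoriCharacterCM
open Summit.HodgeConjecture.HodgeConjecture.Cruxes.H413.K2E3BranchATorusWitnessCM
open Summit.HodgeConjecture.HodgeConjecture.Cruxes.H413.K2E3BranchATypeLettersCM

variable (L : Type) [Field L] [NumberField L] [IsCMField L] (v : HeightOneSpectrum (𝓞 ↥(maximalRealSubfield L)))
  (w : PlacesOver L v) (hw : IsCMField.complexConj L • w.1 = w.1)
  (eA : Gqs L v ≃ₜ* ↥(unitaryGroupOfForm (galAdicCompletionMap (L := L) (IsCMField.complexConj L) hw) ((StdForm.antidiagonal 3).over (w.1.adicCompletion L))))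
  (heA : ∀ g : Gqs L v,
    ((eA g : ↥(unitaryGroupOfForm (galAdicCompletionMap (L := L) (IsCMField.complexConj L) hw) ((StdForm.antidiagonal 3).over (w.1.adicCompletion L)))) :
        GL (Fin 3) (w.1.adicCompletion L)) =
      ((localNonsplitEquiv (IsCMField.complexConj L) (qsForm L) (IsCMField.complexConj_ne_one L) w hw g :
        ↥(unitaryGroupOfForm (galAdicCompletionMap (L := L) (IsCMField.complexConj L) hw) (placeForm (qsForm L) w.1))) : GL (Fin 3) (w.1.adicCompletion L)))
  {ϖ : w.1.adicCompletion L} (hϖ : Valued.v ϖ = WithZero.exp (-1 : ℤ))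
  (g₁ : GL (Fin 3) (w.1.adicCompletion L)) (hg₁ : (g₁ : Matrix (Fin 3) (Fin 3) (w.1.adicCompletion L)) = Matrix.diagonal ![(1 : w.1.adicCompletion L), 1, ϖ])
  (K0 K1 I : Subgroup (Gqs L v))
  (hK0 : K0 = ((glInt 3 (w.1.adicCompletion L)).subgroupOf
    (unitaryGroupOfForm (galAdicCompletionMap (L := L) (IsCMField.complexConj L) hw) ((StdForm.antidiagonal 3).over (w.1.adicCompletion L)))).comap
      eA.toMulEquiv.toMonoidHom)
  (hK1 : K1 = (((glInt 3 (w.1.adicCompletion L)).map (MulAut.conj g₁).toMonoidHom).subgroupOf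
    (unitaryGroupOfForm (galAdicCompletionMap (L := L) (IsCMField.complexConj L) hw) ((StdForm.antidiagonal 3).over (w.1.adicCompletion L)))).comap
      eA.toMulEquiv.toMonoidHom)
  (hI : I = K0 ⊓ K1)

/-! ## §1 reducible ⟹ `det M = 0` -/

open Classical in
include hw heA hϖ hg₁ hK0 hK1 hI in
set_option maxHeartbeats 4000000 in
set_option synthInstance.maxHeartbeats 400000 in
-- the `SmoothInd` carrier on `U(Φ₃)(L⁺_v)` (class of ★ `K2E3BranchBDeterminantZeroDepthZero`)
/-- **reducible ⟹ `det M = 0`** (PAPER-Z3 §2, assembled).  `v` non-split; `χ₁` continuous, non-unitary, contracting, trivial on principal units (depth zero); `w₀` the element of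
matrix `Φ₃`; `μ` a Haar measure on `N(L⁺_v)`; `(f₁, f_w)` a normalised `(I, χ̃)`-type basis of `i(χ₁, 1)` with integrable cell integrands `n ↦ fᵢ(w₀ n g)`, `g ∈ {1, w₀}`.  If
`i(χ₁, 1)` is reducible then `Λ_1 f₁ · Λ_{w₀} f_w − Λ_1 f_w · Λ_{w₀} f₁ = 0`: ★ `exists_typeVector_forall_intertwiningIntegral_eq_zero_of_reducible` (the type vector `f`, `f(1) ≠ 0`,
all `Λ_g f = 0`) + ★ `K2E3BranchBDeterminantZeroDepthZero.det_intertwiningIntegral_eq_zero_of_typeVector`. [cite: Casselman1980, §3] [cite: Casselman1995, §6.4, Thm. 6.6.2]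
[cite: Keys1984, §3, §7 Theorem (2) p. 126] [cite: Roche1998, §3–§4] -/
theorem det_intertwiningIntegral_eq_zero_of_reducible
    (hns : ∀ w' : PlacesOver L v, IsCMField.complexConj L • w'.1 = w'.1)
    (χ₁ : (LocalRing L v)ˣ →* ℂˣ) (h₁ : Continuous fun x => ((χ₁ x : ℂˣ) : ℂ)) (hnu : ∃ x, ‖((χ₁ x : ℂˣ) : ℂ)‖ ≠ 1)
    (hcontr : ∀ x : (LocalRing L v)ˣ, unitModulusChar (LocalRing L v) x < 1 → ‖((χ₁ x : ℂˣ) : ℂ)‖ < 1)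
    (hdepth : ∀ u : (LocalRing L v)ˣ, (∀ w' : PlacesOver L v, Valued.v (((u : LocalRing L v) w') - 1) < 1) → χ₁ u = 1)
    (w₀ : ↥(unitaryGroupOfForm (conjLocal L (IsCMField.complexConj L) v) (cmLocalForm L 3 v))) (hw₀ : Units.val (w₀ : GL (Fin 3) (LocalRing L v)) = cmLocalForm L 3 v)
    [MeasurableSpace ↥(cmBorelTriple L 3 v).N] [BorelSpace ↥(cmBorelTriple L 3 v).N] (μ : Measure ↥(cmBorelTriple L 3 v).N) [μ.IsHaarMeasure]
    (f₁ f_w : haveI := locallyCompactSpace_cmBorelU L 3 v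
      Representation.SmoothInd (cmBorelTriple L 3 v).P
        (Representation.twist (((Representation.trivial ℂ ↥(torusU (conjLocal L (IsCMField.complexConj L) v) (cmLocalForm L 3 v)) ℂ).twist
          (cmTorusCharPair L v χ₁ 1)).comp (cmBorelTriple L 3 v).proj) (rootDeltaChar (cmBorelTriple L 3 v).P)))
    (heig₁ : ∀ x ∈ I, (haveI := locallyCompactSpace_cmBorelU L 3 v; Representation.smoothIndRep _ _ x f₁) = (if h : IsUnit (((x.val : GL (Fin 3) (LocalRing L v)) : Matrix (Fin 3) (Fin 3) (LocalRing L v)) 0 0) then ((χ₁ h.unit : ℂˣ) : ℂ) else 0) • f₁)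
    (heig_w : ∀ x ∈ I, (haveI := locallyCompactSpace_cmBorelU L 3 v; Representation.smoothIndRep _ _ x f_w) = (if h : IsUnit (((x.val : GL (Fin 3) (LocalRing L v)) : Matrix (Fin 3) (Fin 3) (LocalRing L v)) 0 0) then ((χ₁ h.unit : ℂˣ) : ℂ) else 0) • f_w)
    (h11 : f₁.toFun 1 = 1) (h1g : f₁.toFun w₀ = 0) (hw1 : f_w.toFun 1 = 0) (hwg : f_w.toFun w₀ = 1)
    (hi₁₁ : Integrable (fun n : ↥(cmBorelTriple L 3 v).N => f₁.toFun (w₀ * (n : ↥(unitaryGroupOfForm (conjLocal L (IsCMField.complexConj L) v) (cmLocalForm L 3 v))) * 1)) μ)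
    (hiw₁ : Integrable (fun n : ↥(cmBorelTriple L 3 v).N => f_w.toFun (w₀ * (n : ↥(unitaryGroupOfForm (conjLocal L (IsCMField.complexConj L) v) (cmLocalForm L 3 v))) * 1)) μ)
    (hi₁₂ : Integrable (fun n : ↥(cmBorelTriple L 3 v).N => f₁.toFun (w₀ * (n : ↥(unitaryGroupOfForm (conjLocal L (IsCMField.complexConj L) v) (cmLocalForm L 3 v))) * w₀)) μ)
    (hiw₂ : Integrable (fun n : ↥(cmBorelTriple L 3 v).N => f_w.toFun (w₀ * (n : ↥(unitaryGroupOfForm (conjLocal L (IsCMField.complexConj L) v) (cmLocalForm L 3 v))) * w₀)) μ)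
    (hred : ∃ N : Subrepresentation (cmPrincipalSeries L 3 v (cmTorusCharPair L v χ₁ 1)), N ≠ ⊥ ∧ N ≠ ⊤) :
    (∫ n : ↥(cmBorelTriple L 3 v).N, f₁.toFun (w₀ * (n : ↥(unitaryGroupOfForm (conjLocal L (IsCMField.complexConj L) v) (cmLocalForm L 3 v))) * 1) ∂μ) * (∫ n : ↥(cmBorelTriple L 3 v).N, f_w.toFun (w₀ * (n : ↥(unitaryGroupOfForm (conjLocal L (IsCMField.complexConj L) v) (cmLocalForm L 3 v))) * w₀) ∂μ) - (∫ n : ↥(cmBorelTriple L 3 v).N, f_w.toFun (w₀ * (n : ↥(unitaryGroupOfForm (conjLocal L (IsCMField.complexConj L) v) (cmLocalForm L 3 v))) * 1) ∂μ) * (∫ n : ↥(cmBorelTriple L 3 v).N, f₁.toFun (w₀ * (n : ↥(unitaryGroupOfForm (conjLocal L (IsCMField.complexConj L) v) (cmLocalForm L 3 v))) * w₀) ∂μ) = 0 := by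
  haveI := locallyCompactSpace_cmBorelU L 3 v
  obtain ⟨f, heig, hf1, hΛ⟩ := K2E3TypeVectorInKernelDepthZeroCM.exists_typeVector_forall_intertwiningIntegral_eq_zero_of_reducible L v w hw eA heA hϖ g₁ hg₁
    K0 K1 I hK0 hK1 hI hns χ₁ h₁ hnu hcontr hdepth w₀ hw₀ μ hred
  exact K2E3BranchBDeterminantZeroDepthZero.det_intertwiningIntegral_eq_zero_of_typeVector L v w hw eA heA hϖ g₁ hg₁ K0 K1 I hK0 hK1 hI χ₁ w₀ hw₀ μ
    f₁ f_w heig₁ heig_w h11 h1g hw1 hwg hi₁₁ hiw₁ hi₁₂ hiw₂ f heig hf1 (hΛ 1) (hΛ w₀)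

/-! ## §2 The end assembly: reducible + the two big-cell entries ⟹ `χ₁ = η · ‖·‖^{1∕2}` -/

open Classical in
include hw heA hϖ hg₁ hK0 hK1 hI in
set_option maxHeartbeats 4000000 in
set_option synthInstance.maxHeartbeats 400000 in
-- as in §1
/-- **THE d0B END ASSEMBLY AT AN INERT PLACE.**  `v` non-split and UNRAMIFIED in `L`; `χ₁` continuous, non-unitary, contracting, trivial on principal units (depth zero), with
`χ₁(u·σu) = 1` on the units of valuation one (Branch B); `w₀` the element of matrix `Φ₃`; `μ` a Haar measure on `N(L⁺_v)`; `(f₁, f_w)` a normalised `(I, χ̃)`-type basis of `i(χ₁, 1)`;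
signs `ε₀² = c₂² = 1`; the two BIG-CELL entries `Λ_1 f₁ = c₂·(ε₀·((q−1)∕q²)·μ(N₀)·Y∕(1+Y))`, `Λ_{w₀} f_w = −c₂·(ε₀·((q−1)∕q²)·μ(N₀)∕(1+Y))` (`Y = χ₁(ϖ̂)`, `q = N𝔭_v`, `N₀ = {n ∈ N : n ∈ I}`)
with integrable integrands.  If `i(χ₁, 1)` is reducible then **`χ₁ = η · ‖·‖^{1∕2}` for a continuous quadratic character extension `η`** — the second disjunct of :155: §1 (the two
constant integrabilities ★ `integrable_weyl_one`, ★ `integrable_weyl_weyl`) then ★ `exists_eta_of_det_eq_zero_of_bigCellEntries`. [cite: Keys1984, §3, §7 Theorem (2) p. 126]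
[cite: Casselman1980, §3] [cite: Casselman1995, §6.4, Thm. 6.6.2] [cite: Rogawski1990, §12.2 (1)–(2) p. 173] -/
theorem exists_eta_of_reducible_of_bigCellEntries
    (hns : ∀ w' : PlacesOver L v, IsCMField.complexConj L • w'.1 = w'.1)
    (χ₁ : (LocalRing L v)ˣ →* ℂˣ) (h₁ : Continuous fun x => ((χ₁ x : ℂˣ) : ℂ)) (hnu : ∃ x, ‖((χ₁ x : ℂˣ) : ℂ)‖ ≠ 1)
    (hcontr : ∀ x : (LocalRing L v)ˣ, unitModulusChar (LocalRing L v) x < 1 → ‖((χ₁ x : ℂˣ) : ℂ)‖ < 1)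
    (hdepth : ∀ u : (LocalRing L v)ˣ, (∀ w' : PlacesOver L v, Valued.v (((u : LocalRing L v) w') - 1) < 1) → χ₁ u = 1)
    (hunr : Algebra.IsUnramifiedIn (𝓞 L) v.asIdeal)
    (hB : ∀ u : (LocalRing L v)ˣ, (∀ w' : PlacesOver L v, Valued.v ((u : LocalRing L v) w') = 1) →
      χ₁ (u * Units.map (conjLocal L (IsCMField.complexConj L) v : LocalRing L v →* LocalRing L v) u) = 1)
    (w₀ : ↥(unitaryGroupOfForm (conjLocal L (IsCMField.complexConj L) v) (cmLocalForm L 3 v))) (hw₀ : Units.val (w₀ : GL (Fin 3) (LocalRing L v)) = cmLocalForm L 3 v)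
    [MeasurableSpace ↥(cmBorelTriple L 3 v).N] [BorelSpace ↥(cmBorelTriple L 3 v).N] (μ : Measure ↥(cmBorelTriple L 3 v).N) [μ.IsHaarMeasure]
    (f₁ f_w : haveI := locallyCompactSpace_cmBorelU L 3 v
      Representation.SmoothInd (cmBorelTriple L 3 v).P
        (Representation.twist (((Representation.trivial ℂ ↥(torusU (conjLocal L (IsCMField.complexConj L) v) (cmLocalForm L 3 v)) ℂ).twist
          (cmTorusCharPair L v χ₁ 1)).comp (cmBorelTriple L 3 v).proj) (rootDeltaChar (cmBorelTriple L 3 v).P)))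
    (heig₁ : ∀ x ∈ I, (haveI := locallyCompactSpace_cmBorelU L 3 v; Representation.smoothIndRep _ _ x f₁) = (if h : IsUnit (((x.val : GL (Fin 3) (LocalRing L v)) : Matrix (Fin 3) (Fin 3) (LocalRing L v)) 0 0) then ((χ₁ h.unit : ℂˣ) : ℂ) else 0) • f₁)
    (heig_w : ∀ x ∈ I, (haveI := locallyCompactSpace_cmBorelU L 3 v; Representation.smoothIndRep _ _ x f_w) = (if h : IsUnit (((x.val : GL (Fin 3) (LocalRing L v)) : Matrix (Fin 3) (Fin 3) (LocalRing L v)) 0 0) then ((χ₁ h.unit : ℂˣ) : ℂ) else 0) • f_w)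
    (h11 : f₁.toFun 1 = 1) (h1g : f₁.toFun w₀ = 0) (hw1 : f_w.toFun 1 = 0) (hwg : f_w.toFun w₀ = 1)
    (hi₁₁ : Integrable (fun n : ↥(cmBorelTriple L 3 v).N => f₁.toFun (w₀ * (n : ↥(unitaryGroupOfForm (conjLocal L (IsCMField.complexConj L) v) (cmLocalForm L 3 v))) * 1)) μ)
    (hiw₂ : Integrable (fun n : ↥(cmBorelTriple L 3 v).N => f_w.toFun (w₀ * (n : ↥(unitaryGroupOfForm (conjLocal L (IsCMField.complexConj L) v) (cmLocalForm L 3 v))) * w₀)) μ)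
    (ε₀ c₂ : ℂ) (hε : ε₀ ^ 2 = 1) (hc : c₂ ^ 2 = 1)
    (h11v : ∫ n : ↥(cmBorelTriple L 3 v).N, f₁.toFun (w₀ * (n : ↥(unitaryGroupOfForm (conjLocal L (IsCMField.complexConj L) v) (cmLocalForm L 3 v))) * 1) ∂μ =
      c₂ * (ε₀ * ((((Ideal.absNorm v.asIdeal : ℝ) : ℂ) - 1) / ((Ideal.absNorm v.asIdeal : ℝ) : ℂ) ^ 2) * ((μ.real {m : ↥(cmBorelTriple L 3 v).N | (m : ↥(unitaryGroupOfForm (conjLocal L (IsCMField.complexConj L) v) (cmLocalForm L 3 v))) ∈ I} : ℝ) : ℂ) * ((χ₁ (isUnit_toLocalRing_uniformizer L v).unit : ℂˣ) : ℂ) / (1 + ((χ₁ (isUnit_toLocalRing_uniformizer L v).unit : ℂˣ) : ℂ))))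
    (hwwv : ∫ n : ↥(cmBorelTriple L 3 v).N, f_w.toFun (w₀ * (n : ↥(unitaryGroupOfForm (conjLocal L (IsCMField.complexConj L) v) (cmLocalForm L 3 v))) * w₀) ∂μ =
      -(c₂ * (ε₀ * ((((Ideal.absNorm v.asIdeal : ℝ) : ℂ) - 1) / ((Ideal.absNorm v.asIdeal : ℝ) : ℂ) ^ 2) * ((μ.real {m : ↥(cmBorelTriple L 3 v).N | (m : ↥(unitaryGroupOfForm (conjLocal L (IsCMField.complexConj L) v) (cmLocalForm L 3 v))) ∈ I} : ℝ) : ℂ) / (1 + ((χ₁ (isUnit_toLocalRing_uniformizer L v).unit : ℂˣ) : ℂ)))))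
    (hred : ∃ N : Subrepresentation (cmPrincipalSeries L 3 v (cmTorusCharPair L v χ₁ 1)), N ≠ ⊥ ∧ N ≠ ⊤) :
    ∃ η : (LocalRing L v)ˣ →* ℂˣ, IsQuadraticCharExtension (conjLocal L (IsCMField.complexConj L) v) η ∧
      Continuous (fun x => ((η x : ℂˣ) : ℂ)) ∧ χ₁ = η * halfModulusChar (LocalRing L v) :=
  K2E3KeysThmTwoDepthZeroBranchBFromDet.exists_eta_of_det_eq_zero_of_bigCellEntries L v w hw eA heA hϖ g₁ hg₁ K0 K1 I hK0 hK1 hI hns hunr χ₁ h₁ hcontr hB w₀ hw₀ μ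
    f₁ f_w heig₁ heig_w h11 h1g hw1 hwg ε₀ c₂ hε hc h11v hwwv
    (det_intertwiningIntegral_eq_zero_of_reducible L v w hw eA heA hϖ g₁ hg₁ K0 K1 I hK0 hK1 hI hns χ₁ h₁ hnu hcontr hdepth w₀ hw₀ μ
      f₁ f_w heig₁ heig_w h11 h1g hw1 hwg hi₁₁
      (K2E3KeysThmTwoDepthZeroBranchBConstants.integrable_weyl_one L v w hw eA heA hϖ g₁ hg₁ K0 K1 I hK0 hK1 hI χ₁ w₀ hw₀ μ f_w heig_w hw1 hwg)
      (K2E3KeysThmTwoDepthZeroBranchBConstants.integrable_weyl_weyl L v w hw eA heA hϖ g₁ hg₁ K0 K1 I hK0 hK1 hI χ₁ w₀ hw₀ μ f₁ heig₁ h11 h1g)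
      hiw₂ hred)

end Summit.HodgeConjecture.HodgeConjecture.Cruxes.H413.K2E3KeysThmTwoDepthZeroBranchBAssembly

end
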